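import Summits.QuantumFields.BalabanUV.Beta.FP.RoadLeftLiteralSComp
import Summits.QuantumFields.BalabanUV.Beta.FP.CompositeStencilTables

/-!
# `BalabanUV.Beta.FP.RoadLeftLiteralSfoldComp` — road «FP» for binder row D1, RULING R-FP-50 (b) row END-REBASE, PART 3 (terminal): THE RE-BASED FREE-S END
# (`RoadLeftLiteralSComp.d1Drift_JsB12Sym_of_sliceLedger_ghost_SComp`, part 2, p306096) AT THE COMPOSITE OBJECTS OF RECORD —
# `Sc := SfoldComp Lc (qSym Lc) lamPerfect tabs.V Spure cVHc SLam`, `Wc := WtComp Lc (qSym Lc) lamPerfect Spure cVHc ε₂ Gc tabs cΛ S₂inf cBc`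
# (leaf-02 `CompositeStencilTables` p306484, R-FP-50 (a)) — ONE `exact`

HONEST DEPENDENCY (page 1, mandatory): continuum YM on T⁴ ⇐ BetaPertH ∧ nine spine estimates (0/9 proved); BetaPertH ⇐ (D1) ∧ (D4) ∧ CAP+tail;
G-an2-4 gates asym, D1 and NE2/3/4.  HONEST FRAMING (cell contract, verbatim): «discharging `BetaPertH` makes Bałaban's UV stability UNCONDITIONAL —
a real constructive-QFT result; it is NOT the continuum limit and NOT the Clay problem.»  THIS MODULE is [our object] COMPOSITION BY NAME (one chain link
downstream of part 2 `RoadLeftLiteralSComp`, the pattern of this lineage's L4 `RoadLeftLiteralSRecord` p261482); no `def`, no `def … : Prop`, nothing cited, 0 sorry.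
RULING R-FP-50 [D1P3-G16-RFP50] (journal 2026-08-21T20:14Z): (a) OBJECTS OF RECORD for `m ≥ 2` — `SpureComp m := SΔ∞ + cVH^{(m)}•V^{(m)}`, `SfoldComp m := SpureComp m +
SLam m`, `WtComp m := WtInf (G m) (Lc^m) (SpureComp m) (S₂Comp m)` — LANDED by leaf-02 g15 (`FP/CompositeBorderTables` p305618, `…Letters` p305907, `FP/CompositeStencilTables`
p306484); (b) THE END CONSUMED — the FREE-S END re-based at `S j 1 := (JsB12Sym …).S`, `S j m := counitS_j (SfoldComp m)` (m ≥ 2), `Wt` likewise with `WtComp` — parts 1–2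
LANDED by this lineage (`FP/PerfectStencilPin` p305819, `FP/RoadLeftLiteralSComp` p306096, generic in `Sc Wc` with THREE displayed letters `hSc hδsc hcovc` of `Sc`).
HERE (part 3): `Sc`, `Wc` ARE PINNED to leaf-02's objects over the RECORD inputs `(qSym Lc, lamPerfect, tabs.V, tabs.vh₂S)`, and the three letters are DISCHARGED —
`hSc`∕`hδsc` ⟸ `CompositeStencilTables.locStencil_SfoldComp` (∃-form, chosen inside) fed by the record-level `qSym_decays` ∕ `SymTables.hV` and the displayed letters of
`Spure` (=: `S♭∞`, the m = 1 pure stencil: ONE locality letter `hSp` at a rate `δsp > 0`) and of the fold family (`hL`, `hδL`); `hcovc` ⟸ `CompositeStencilTables.SpureComp_translate`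
fed by `qSym_translate`, `SymTables.hVt`, the (St♭) of `Spure` at blocking `Lc` (`hSpt`) + the fold family's own `Lc^m`-covariance (`hLt`) — the junction checked by signature
both ways (leaf-02 W-d1leaf02g15-6, journal l.36130; leaf-06 X8 C-d1leaf06g15-8).  STILL DISPLAYED (as in part 2): `Spure` + `hSp hδsp hSpt`, `cVHc`, `SLam` + `hL hδL hLt`
(the composite Λ-fold — an4's fold API; `SLamComp` is NOT pinned here, R-FP-50 (a) «or hand `SLamComp` to whoever holds an4's fold API»), the W-side objects `ε₂ Gc S₂inf cBc`
(NO letter of theirs is consumed by the END: `Wc` enters only `hSDF`∕`hsplit`, which stay displayed), and EVERYTHING ELSE OF PART 2 VERBATIM (the (CONV-C) undressed rows, PART 3b,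
the slice data and (rem) ledger, `hWj`, `hSDF`, the W-split).  K-SLOT PLACEMENT CAVEAT (D2 §3 ∕ R-FP-44 (B) Q2): `Gc : ℕ → MKer` stays a PARAMETER.  SCOPE (E-FP-16-2 ∕ Q-FP-16-6 ∕
R-FP-51): leaf-02's objects carry the AVERAGING rows («GO modulo Q-FP-16-6»); under R-FP-51 ROUTE T the slice rows live in the SLICED torus instances, so this pin is the
route-neutral pin the OWNER asked for (R-FP-50 ASSIGNMENTS «leaf-06 — the terminal END re-base … after leaf-02's objects land»).  0∕4 row-D1 binders; NOT (CONV-C), NOT X1 (m = 1),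
NOT hWj, NOT SDF, NOT hslice, NOT (ASYMP), NOT the letters of `S♭∞`∕`SLam` (displayed), NOT D1, NOT BetaPertH, NOT continuum, NOT Clay.  «not in print; our bookkeeping».
ABSOLUTE RULE (cell charter, verbatim): «No internally-minted statement may enter as a cited fact. Every hypothesis is either kernel-proved in this package or a
verbatim quotation of a PUBLISHED theorem with page reference. The manuscript(s) under audit are NOT citable for their own disputed steps — they are the thing
under adjudication; programme-internal (2001/route/tribunal) claims are never citable.»
CONTENT: [our object] **`d1Drift_JsB12Sym_of_sliceLedger_ghost_SfoldComp`** — conclusion `D1Drift Lc (JsB12Sym hOdd Ncol tabs cΛ cB) N μ ν`.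
Provenance: D1 formalisation swarm LEAF PROVER 06, unit b2b-balaban-beta-d1-formalise-leaf-06 gen 16, 2026-08-21 (OWNER d1-p3 g16 R-FP-50 ASSIGNMENTS l.35761; R-FP-51
CONFIRMED l.36401 «part 3 after leaf-02's `CompositeStencilTables`»; SEAT-CLOSING l.36574 (2)).  No existing file touched.
-/

noncomputable section

namespace Summit.QuantumFields.BalabanUV.Beta.FP.RoadLeftLiteralSfoldComp

open Finset
open scoped BigOperators
open Literature.MathematicalPhysics.QuantumFieldTheory.Balaban1983to89
open Literature.MathematicalPhysics.QuantumFieldTheory.Balaban1983to89.Beta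
open Literature.MathematicalPhysics.QuantumFieldTheory.Balaban1983to89.Beta.BubbleTransfer (c4)
open Literature.MathematicalPhysics.QuantumFieldTheory.Balaban1983to89.B12Normalization (stepBal)
open B12Sec2to5 (l1 l1_nonneg)
open PolarizationSign (AxisReflectionCovariant reflSign)
open ExpKernelCalculus (Site MKer BiLoc comp shiftK tr tadpole bubble Zl Zl_nonneg)
open KernelWard (Bdd divV divW)
open KernelReflection (LegMap refK bondRefl tadpole_smul bubble_smul_left bubble_smul_right)
open StepJetData (biLoc_smul)
open OneStepResolventKernel (Fib LocStencil)
open OneStepKernelFamily (flipK colH)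
open DyadicShell (Pt supNorm)
open LeadingCoefficient (kappaBal)
open AxialProjector (coProj)
open AxialDressing (axDressK)
open SecondOrderResponse (vertex2OfK)
open Summit.QuantumFields.BalabanUV.Beta.GAN24.CombesThomas (sfStep smStep)
open Summit.QuantumFields.BalabanUV.Beta.D1BFx.MomentTransferPeriodicEntry (EKer₂ dressedEntryP)
open Summit.QuantumFields.BalabanUV.Beta.D1BFx.ReducedKernelSandwichLeg (fineHessA fineHessA_apply)
open Summit.QuantumFields.BalabanUV.Beta.D1BFx.DressedTablesLeg (tadpoleTableA_apply bubbleTableA_apply)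
open Summit.QuantumFields.BalabanUV.Beta.D1BFx.PackedKernelSplit (inj blk biLoc_blk)
open Summit.QuantumFields.BalabanUV.Beta.D1BFx.ContactCount (abs_comp_le_of_entryBound abs_comp_le_of_rightLoc abs_tr_le_of_rightLoc
  abs_tadpole_le_of_entryBound abs_bubble_le_of_entryBound)
open Summit.QuantumFields.BalabanUV.Beta.FP.PerfectObjectsT (KPerf TPerfOf)
open Summit.QuantumFields.BalabanUV.Beta.FP.WilsonCubicGerm (cubicGermOf)
open Summit.QuantumFields.BalabanUV.Beta.FP.GhostCubicGerm (cubicGermOfSc)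
open Summit.QuantumFields.BalabanUV.Beta.FP.BubbleGermValue (bfGerm ghostGerm)
open Summit.QuantumFields.BalabanUV.Beta.FP.PerfectPolarization (Pker G0ker PiBF)
open Summit.QuantumFields.BalabanUV.Beta.FP.PerfectPolarizationWard (bdd_Pker)
open Summit.QuantumFields.BalabanUV.Beta.FP.FineHessianGluonCore (fineHessA_gluonCore fineHessA_Pker_eq_ff bdd_smul)
open Summit.QuantumFields.BalabanUV.Beta.FP.FineHessianTransportTable (PiBF_eq_fineHessA)
open Summit.QuantumFields.BalabanUV.Beta.FP.FineHessianNearLedgerGen (hasym_PiBF_of_sliceLedger_gen)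
open Summit.QuantumFields.BalabanUV.Beta.FP.FineHessianNearLedgerCore (abs_ite_le bdd_blk nearSplit_of_slice bounded_seven)
open DecimatedMomentSummable (ConstReproSum LinReproSum)
open Summit.QuantumFields.BalabanUV.Beta.FP.TransportInfinityM (colOf)
open SecondOrderResponse (vertex2OfK)
open OneStepKernelFamily (vertexOfK)
open ExpKernelCalculus (hessKer Decays)
open Summit.QuantumFields.BalabanUV.Beta.FP.PerfectColumnTransportTail (transportLetters_perfCol)
open Summit.QuantumFields.BalabanUV.Beta.FP.PerfectColumnSharp (abs_colOf_KPerf_le_sharp)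
open Summit.QuantumFields.BalabanUV.Beta.FP.StepLawKHolds (exists_decays_KPerf_holds)
open Summit.QuantumFields.BalabanUV.Beta.FP.SymmetryK (shiftK_KPerf)
open Summit.QuantumFields.BalabanUV.Beta.FP.GenericResolventSandwich (hessKer_self_eq_dressedEntryP)
open Summit.QuantumFields.BalabanUV.Beta.FP.FineSplitJunctionNearFar (exists_bound_fineHessA)
open OneStepResolventKernel (JetData)
open OneStepKernelFamily (D1Drift)
open ExpKernelCalculus (VertexFamily₂)
open Summit.QuantumFields.BalabanUV.Beta.HessKerDressedUnits (unitS unitW)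
open Summit.QuantumFields.BalabanUV.Beta.TameKernelCalculus (Loc)
open Summit.QuantumFields.BalabanUV.Beta.FP.PerfectObjects (KTot)
open Summit.QuantumFields.BalabanUV.Beta.FP.PerfectObjectsT (SPerfOf WPerfOf)
open Summit.QuantumFields.BalabanUV.Beta.FP.RoadEndGeneric (fPerfG)
open Summit.QuantumFields.BalabanUV.Beta.FP.RoadEndLeft (d1Drift_left_of_step_law_wslot_split)
open Summit.QuantumFields.BalabanUV.Beta.FP.RoadAsympEndLeft (hasym_PiBF_of_sliceLedger_left)
open Summit.QuantumFields.BalabanUV.Beta.FP.RoadLeftAssemblySDF (d1Drift_left_of_sliceLedger_sdf)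
open Summit.QuantumFields.BalabanUV.Beta.FP.SymmetryInheritGeneric (wardTransversal_flipK_TGenOf_one_of_wardRow swap_TGenOf_one_of_swapRow)
open Summit.QuantumFields.BalabanUV.Beta.HessKerConvCKPlug (exists_merged_rows)
open Summit.QuantumFields.BalabanUV.Beta.GAN24.CombesThomas (sfStep_ne_zero smStep_ne_zero)
open Summit.QuantumFields.BalabanUV.Beta.GAN24.KSlotAssembly (convCKWall_holds)
open Summit.QuantumFields.BalabanUV.Beta.HessKerFourFamily (TbalOf_apply)
open HessKerDressedLimit (vertexFamily₂_limTabOf)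
open OneStepKernelFamily (TbalOf)
open Summit.QuantumFields.BalabanUV.Beta.FP.StepLawLeft (stepLaw_left_of_ward_symm_explicitDefect)
open Summit.QuantumFields.BalabanUV.Beta.FP.StepDefectInherit (defect)
open Summit.QuantumFields.BalabanUV.Beta.FP.TransportInfinityM (colOf)
open DressedMomentNormalisation (dressedEntry)
open PolarizationSign (WardTransversal)
open OneStepKernelFamily (flipK vertexOfK)
open KernelWard (biLoc_add)
open OneStepResolventKernel (biLoc_mono)
open ExpKernelCalculus (BiLoc)
open Summit.QuantumFields.BalabanUV.Beta.FP.PerfectObjectsT (KPerf)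
open Summit.QuantumFields.BalabanUV.Beta.FP.BiVertexSlotLetters (vertexFamily₂_vertex2OfK_of_biLoc hloc₀_of_jetLetters hs₀_of_jetLetters
  hlocx_of_extraLetter hsx_of_extraLetter)
open AffineAveraging (toSite)
open Summit.QuantumFields.BalabanUV.Beta.SymmetrisedStepJets
open Summit.QuantumFields.BalabanUV.Beta.FP.PerfectJetLetters (sPerf_letters_of_rows)
open Summit.QuantumFields.BalabanUV.Beta.FP.RoadEndLeftUndressed (sRow_JsB12Sym_of_undressed sRowAll_JsB12Sym_of_undressed
  wRow_JsB12Sym_of_undressed wRowAll_JsB12Sym_of_undressed JsB12Sym_S_translate_pow_one)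
open Summit.QuantumFields.BalabanUV.Beta.FP.RoadLeftAssemblyLetters (d1Drift_left_of_sliceLedger_rows_letters)
open Summit.QuantumFields.BalabanUV.Beta.FP.RoadLeftLiteralSwap (hTj_JsB12Sym)
open Summit.QuantumFields.BalabanUV.Beta.FP.RoadLeftLiteralRowsLetters (d1Drift_JsB12Sym_of_sliceLedger_rows_letters)
open Summit.QuantumFields.BalabanUV.Beta.D1BFx.GhostStencil (ghCur)
open Summit.QuantumFields.BalabanUV.Beta.D1BFx.ReducedKernelSandwichBlock (diagExt)
open Summit.QuantumFields.BalabanUV.Beta.D1BFx.GhostStencilReflection (ghX)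
open Summit.QuantumFields.BalabanUV.Beta.FP.PerfectPolarizationWardLetters (projU)
open Summit.QuantumFields.BalabanUV.Beta.FP.GhostBiTableLaw (ghost_sector_letters)
open Literature.MathematicalPhysics.QuantumFieldTheory.Balaban1983to89.Beta.StepJetData (biLoc_weaken)
open Summit.QuantumFields.BalabanUV.Beta.AxialDressingRooted (cKb cKb')
open Summit.QuantumFields.BalabanUV.Beta.FP.RoadLeftLiteralGhost (d1Drift_JsB12Sym_of_sliceLedger_ghost)
open Summit.QuantumFields.BalabanUV.Beta.FP.PerfectSecondOrderTablesInf (WtPin WtPin_one)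
open Summit.QuantumFields.BalabanUV.Beta.FP.PerfectStencilPin (StPin StPin_one SPerfPin WPerfPin sPerfOf_StPin wPerfOf_WtPin locStencil_unitS_StPin_of_ne_one
  locStencil_unitS_StPin_sub_of_ne_one StPin_translate_of_ne_one)
open Summit.QuantumFields.BalabanUV.Beta.FP.RoadLeftLiteralSComp (d1Drift_JsB12Sym_of_sliceLedger_ghost_SComp)
open Summit.QuantumFields.BalabanUV.Beta.FP.PerfectSecondOrderTablesInf (qSym lamPerfect)
open Summit.QuantumFields.BalabanUV.Beta.FP.PerfectSecondOrderTablesTranslate (qSym_translate)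
open Summit.QuantumFields.BalabanUV.Beta.FP.CompositeStencilTables (SfoldComp WtComp SfoldComp_apply SpureComp_translate locStencil_SfoldComp qSym_decays)

variable {Lc : ℕ} [NeZero Lc]

/-- **ROAD «FP» — THE TERMINAL FREE-S END RE-BASED AT THE COMPOSITE OBJECTS OF RECORD (R-FP-50 (b), part 3)** [our object]: part 2
`RoadLeftLiteralSComp.d1Drift_JsB12Sym_of_sliceLedger_ghost_SComp` at `Sc := SfoldComp Lc (qSym Lc) lamPerfect tabs.V Spure cVHc SLam`,
`Wc := WtComp Lc (qSym Lc) lamPerfect Spure cVHc ε₂ Gc tabs cΛ S₂inf cBc` (leaf-02 `CompositeStencilTables`); the three letters `hSc hδsc hcovc` of part 2 are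
DISCHARGED from leaf-02's `locStencil_SfoldComp` ∕ `SpureComp_translate` over the record inputs and the displayed letters of `Spure` (`hSp hδsp hSpt`) and of
the fold family (`hL hδL hLt`); everything else verbatim.  For `m ≥ 2` the rows `hfar`, `hslice`, `hSDF`, `hsplit` now read leaf-02's EXPLICIT composite objects.
CONCLUSION: `D1Drift Lc (JsB12Sym hOdd Ncol tabs cΛ cB) N μ ν`. -/
theorem d1Drift_JsB12Sym_of_sliceLedger_ghost_SfoldComp (hLc : 2 ≤ Lc) (hOdd : Odd Lc) (Ncol : ℕ) (tabs : SymTables 3 Lc) (cΛ cB : ℝ)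
    -- R-FP-50 (a)∕(b): THE COMPOSITE OBJECTS OF RECORD PINNED INSIDE — `Sc := SfoldComp Lc (qSym Lc) lamPerfect tabs.V Spure cVHc SLam`,
    -- `Wc := WtComp Lc (qSym Lc) lamPerfect Spure cVHc ε₂ Gc tabs cΛ S₂inf cBc` (leaf-02 `CompositeStencilTables` p306484) over the RECORD inputs
    -- `(qSym Lc, lamPerfect, tabs.V, tabs.vh₂S)`; DISPLAYED: the m = 1 pure stencil letter `Spure` (=: `S♭∞`) with ONE locality letter and its (St♭) at blocking `Lc`,
    -- the border scalars `cVHc`, the composite Λ-fold family `SLam` (an4's fold API; read for `m ≥ 2`) with its locality and `Lc^m`-covariance letters, and the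
    -- W-side displayed objects `ε₂ Gc S₂inf cBc` (NO letter of theirs is consumed; supplier remark W-d1leaf02g16-1: for `m ≥ 2` `S₂Comp` reads `cBc 1` as the
    -- literal's `cB` — a caller wanting the record's border part passes `cBc` with `cBc 1 = cB`; nothing below depends on it)
    (Spure : Fin (3 + 1) → (Fin (3 + 1) → ℤ) → MKer (3 + 1) (Fib 3)) {Cs δsp : ℝ} (hSp : LocStencil Spure Cs δsp) (hδsp : 0 < δsp)
    (hSpt : ∀ (κ : Fin (3 + 1)) (u t : Fin (3 + 1) → ℤ), Spure κ (u + (Lc : ℤ) • t) = shiftK (-((Lc : ℤ) • t)) (Spure κ u))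
    (cVHc : ℕ → ℝ) (SLam : ℕ → Fin (3 + 1) → (Fin (3 + 1) → ℤ) → MKer (3 + 1) (Fib 3)) {CL δL : ℕ → ℝ}
    (hL : ∀ m : ℕ, 2 ≤ m → LocStencil (SLam m) (CL m) (δL m)) (hδL : ∀ m : ℕ, 2 ≤ m → 0 < δL m)
    (hLt : ∀ m : ℕ, 2 ≤ m → ∀ (κ : Fin (3 + 1)) (u t : Fin (3 + 1) → ℤ),
      SLam m κ (u + ((Lc ^ m : ℕ) : ℤ) • t) = shiftK (-(((Lc ^ m : ℕ) : ℤ) • t)) (SLam m κ u))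
    (ε₂ : ℝ) (Gc : ℕ → MKer (3 + 1) (Fib 3)) (S₂inf : Fin (3 + 1) → (Fin (3 + 1) → ℤ) → Fin (3 + 1) → (Fin (3 + 1) → ℤ) → MKer (3 + 1) (Fib 3)) (cBc : ℕ → ℝ)
    -- (CONV-C) S-slot and W-slot rows of the UNDRESSED unit-rescaled jets of `JsB12Sym0` (row G-an2-4; HYPOTHESES; the dressing is bookkeeping, `RoadEndLeftUndressed` §2)
    {Cs0 cS δS θS Cw0 cW δW θW : ℝ}
    (hS0 : ∀ j, LocStencil (unitS (sfStep Lc j) (smStep 3 Lc j) (JsB12Sym0 hOdd Ncol tabs cΛ cB j).S) Cs0 δS)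
    (hSall0 : ∀ k j, LocStencil (unitS (sfStep Lc (k + j)) (smStep 3 Lc (k + j)) (JsB12Sym0 hOdd Ncol tabs cΛ cB (k + j)).S -
      unitS (sfStep Lc k) (smStep 3 Lc k) (JsB12Sym0 hOdd Ncol tabs cΛ cB k).S) (cS * θS ^ k) δS)
    (hW0 : ∀ j, VertexFamily₂ (unitW (sfStep Lc j) (smStep 3 Lc j) (JsB12Sym0 hOdd Ncol tabs cΛ cB j).W) Lc Cw0 δW)
    (hWall0 : ∀ k j, VertexFamily₂ (unitW (sfStep Lc (k + j)) (smStep 3 Lc (k + j)) (JsB12Sym0 hOdd Ncol tabs cΛ cB (k + j)).W -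
      unitW (sfStep Lc k) (smStep 3 Lc k) (JsB12Sym0 hOdd Ncol tabs cΛ cB k).W) Lc (cW * θW ^ k) δW)
    (hδS : 0 < δS) (hδW : 0 < δW) (hθS0 : 0 ≤ θS) (hθS1 : θS < 1) (hθW0 : 0 ≤ θW) (hθW1 : θW < 1)
    -- the BF comparison data: colour weights and the admissible families (PART 3b's list starts here)
    (wg wgh : ℝ)
    {V : Fin 4 → Site 4 → MKer 4 (Fib 3)} {W : Fin 4 → Site 4 → Fin 4 → Site 4 → MKer 4 (Fib 3)} {Cv Cw Cx CwL cQ δ : ℝ} (hδ : 0 < δ)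
    -- admissible-family letters, gluon sector
    (hV : ∀ (μ : Fin 4) (y : Site 4), BiLoc (V μ y) y y Cv δ) (hW : ∀ (μ : Fin 4) (y : Site 4) (ν : Fin 4) (y' : Site 4), BiLoc (W μ y ν y') y y' Cw δ)
    (hcovV : ∀ (μ : Fin 4) (y t : Site 4), V μ (y + t) = shiftK (-t) (V μ y))
    (hcovW : ∀ (μ : Fin 4) (y : Site 4) (ν : Fin 4) (y' t : Site 4), W μ (y + t) ν (y' + t) = shiftK (-t) (W μ y ν y'))
    (X : Site 4 → MKer 4 (Fib 3)) (hX : ∀ y, BiLoc (X y) y y Cx δ)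
    (hW1 : ∀ y, comp (comp Pker (divV V y)) Pker = comp Pker (X y) - comp (X y) Pker)
    (hW2 : ∀ y ν y', divW W y ν y' = comp (X y) (V ν y') - comp (V ν y') (X y))
    -- (Kcov) of the BF comparison kernel, its ghost sector AT THE EXPLICIT PAIR `(ghCur, diagExt (−ghX))` — DISPLAYED (its ghost half from the gluon letters:
    -- `GhostBiTableReflection.axisReflectionCovariant_flipK_PiBF_ghostX`; the gluon half is leaf-02's R10 ∕ N-d1leaf02g10-3)
    (hKcov : AxisReflectionCovariant (flipK (PiBF wg wgh V W ghCur (diagExt fun κ u => (-1 : ℝ) • ghX κ u))))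
    (h0V : ∀ (lam α β : Fin 4), ∑' p : Pt × Pt, V lam 0 p.1 p.2 (Sum.inl α) (Sum.inl β) = 0)
    (hgermV : cubicGermOf V = cQ • bfGerm)
    (hWloc : ∀ (μ ν : Fin 4) (z : Pt), BiLoc (W μ 0 ν z) 0 z (CwL * Real.exp (-δ * l1 z)) δ)
    -- (the ghost-sector letters `hv hw hcovv hcovw hXg hW1g hW2g h0v hgermv hwloc` are THEOREMS at `(ghCur, diagExt (−ghX), −projU)` —
    -- `GhostBiTableLaw` ∕ `GhostCubicGerm` ∕ `GhostGaugeLaw` — and are supplied INSIDE)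
    -- the colour weights and the entry
    {N : ℝ} (hn : (40 * wg * (1 / 4 : ℝ) * (c4 * cQ) ^ 2 - wgh * (-(1 / 2 : ℝ)) * c4 ^ 2) / 3 = kappaBal N)
    {μ ν : Fin 4} (hμν : μ ≠ ν)
    -- the X1m-S rows (`hSm hSmall hθm hδsm hcov2`) are DISCHARGED: m = 1 from `hS0 hSall0 hθS1 hδS` (as `RoadLeftLiteralSRecord`), m ≥ 2 from leaf-02's
    -- letters `locStencil_SfoldComp` ∕ `SpureComp_translate` + `hL hδL hLt` (`PerfectStencilPin` §2)
    {Wf : ℕ → Fin (3 + 1) → (Fin (3 + 1) → ℤ) → Fin (3 + 1) → (Fin (3 + 1) → ℤ) → MKer (3 + 1) (Fib 3)}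
    (hWf : ∀ m : ℕ, 1 ≤ m → ∃ C2 δ2 : ℝ, 0 < δ2 ∧ (∀ κ' u l' u', BiLoc (Wf m κ' u l' u') u u' C2 δ2) ∧
      ∀ κ' u l' u' t, Wf m κ' (u + ((Lc ^ m : ℕ) : ℤ) • t) l' (u' + ((Lc ^ m : ℕ) : ℤ) • t)
        = shiftK (-(((Lc ^ m : ℕ) : ℤ) • t)) (Wf m κ' u l' u'))
    -- the FAR LETTER of the full fine kernel (m-free shape)
    {CF af : ℝ} (hCF : 0 ≤ CF) (haf : 0 < af)
    (hfar : ∀ m : ℕ, 1 ≤ m → ∀ (c e : Fin 4) (s s' : Pt), Lc ^ m < supNorm (s' - s) →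
      |fineHessA (KPerf (d := 3) Lc (sfStep Lc) (smStep 3 Lc) m)
        (SPerfPin Lc (fun j => (JsB12Sym hOdd Ncol tabs cΛ cB j).S) (SfoldComp Lc (qSym Lc) lamPerfect tabs.V Spure cVHc SLam) m) (Wf m) c e s s'|
        ≤ ((Lc ^ m : ℕ) : ℝ) ^ 8 * (CF / (supNorm (s' - s) : ℝ) ^ 6 * Real.exp (-(af / ((Lc ^ m : ℕ) : ℝ)) * (supNorm (s' - s) : ℝ))))
    -- THE DISPLAYED SLICE DATA per `m`: units and bubble weight, remainder leg, slice stencils∕bi-tables, and the slice exchange `hslice`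
    {c a b κ : ℕ → ℝ} (hunits₁ : ∀ m : ℕ, 1 ≤ m → (((Lc ^ m : ℕ) : ℝ) ^ 8) * wg = c m * b m)
    (hunits₂ : ∀ m : ℕ, 1 ≤ m → (((Lc ^ m : ℕ) : ℝ) ^ 8) * wg = κ m * (c m ^ 2 * a m ^ 2))
    {R : ℕ → MKer 4 (Fin 4)} (hRb : ∀ m : ℕ, 1 ≤ m → ∃ CR, Bdd (R m) CR)
    {Ssl : ℕ → Fin 4 → Site 4 → MKer 4 (Fin 4)} (hSsl : ∀ m : ℕ, 1 ≤ m → ∃ Cs, ∀ κ u, BiLoc (Ssl m κ u) u u Cs δ)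
    {Wsl : ℕ → Fin 4 → Site 4 → Fin 4 → Site 4 → MKer 4 (Fin 4)} (hWsl : ∀ m : ℕ, 1 ≤ m → ∃ C2, ∀ κ u l u', BiLoc (Wsl m κ u l u') u u' C2 δ)
    {Fmix Fgh FN : ℕ → EKer₂ 4}
    (hslice : ∀ m : ℕ, 1 ≤ m → ∀ (c' e : Fin 4) (s s' : Pt),
      fineHessA (KPerf (d := 3) Lc (sfStep Lc) (smStep 3 Lc) m)
        (SPerfPin Lc (fun j => (JsB12Sym hOdd Ncol tabs cΛ cB j).S) (SfoldComp Lc (qSym Lc) lamPerfect tabs.V Spure cVHc SLam) m) (Wf m) c' e s s'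
        = ((1 / 2 : ℝ) * tadpole (c m • blk Pker true true + R m) (Wsl m c' s e s')
            - (1 / 2 : ℝ) * κ m * bubble (c m • blk Pker true true + R m) (Ssl m c' s) (Ssl m e s'))
          + Fmix m c' e s s' + Fgh m c' e s s' + FN m c' e s s')
    -- THE DISPLAYED MIX SPLIT (α2-a PART 2) and GHOST SPLIT (α2-c) into bounded pieces, and the normalisation piece's bound
    {ιM : Type*} (JM : Finset ιM) {Gmix : ιM → ℕ → EKer₂ 4}
    (hmix : ∀ m : ℕ, 1 ≤ m → ∀ (c' e : Fin 4) (s s' : Pt),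
      (if supNorm (s' - s) ≤ Lc ^ m then Fmix m c' e s s' else 0) = ∑ k ∈ JM, Gmix k m c' e s s')
    (hGmix : ∀ k ∈ JM, ∀ m : ℕ, 1 ≤ m → ∀ c' e : Fin 4, ∃ A, ∀ s s', |Gmix k m c' e s s'| ≤ A)
    {ιG : Type*} (JG : Finset ιG) {Ggh : ιG → ℕ → EKer₂ 4}
    (hgh : ∀ m : ℕ, 1 ≤ m → ∀ (c' e : Fin 4) (s s' : Pt),
      (if supNorm (s' - s) ≤ Lc ^ m then Fgh m c' e s s'
          + ((Lc ^ m : ℕ) : ℝ) ^ 8 * wgh * fineHessA G0ker ghCur (diagExt fun κ u => (-1 : ℝ) • ghX κ u) c' e s s' else 0)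
        = ∑ k ∈ JG, Ggh k m c' e s s')
    (hGgh : ∀ k ∈ JG, ∀ m : ℕ, 1 ≤ m → ∀ c' e : Fin 4, ∃ A, ∀ s s', |Ggh k m c' e s s'| ≤ A)
    (hFN : ∀ m : ℕ, 1 ≤ m → ∀ c' e : Fin 4, ∃ A, ∀ s s', |FN m c' e s s'| ≤ A)
    -- THE (rem) LEDGER: one number per named piece
    {B7 : Fin 7 → ℝ} {Bmix : ιM → ℝ} {Bgh : ιG → ℝ} {BN : ℝ}
    (hL0 : ∀ m : ℕ, 1 ≤ m → ∀ S' : Finset Pt, ∑ u ∈ S', (supNorm u : ℝ) ^ 2 *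
      |dressedEntryP (fun c'' a' => colH (KPerf (d := 3) Lc (sfStep Lc) (smStep 3 Lc) m) (Lc ^ m) a' 0 c'')
        (fun c' e s s' => if supNorm (s' - s) ≤ Lc ^ m then (1 / 2 : ℝ) * tadpole (R m) (Wsl m c' s e s') else 0)
        (((Lc ^ m : ℕ) : ℤ) • (-u)) μ ν| ≤ B7 0)
    (hL1 : ∀ m : ℕ, 1 ≤ m → ∀ S' : Finset Pt, ∑ u ∈ S', (supNorm u : ℝ) ^ 2 *
      |dressedEntryP (fun c'' a' => colH (KPerf (d := 3) Lc (sfStep Lc) (smStep 3 Lc) m) (Lc ^ m) a' 0 c'')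
        (fun c' e s s' => if supNorm (s' - s) ≤ Lc ^ m then
          -((1 / 2 : ℝ) * κ m) * tr (comp (comp (c m • blk Pker true true) (Ssl m c' s)) (comp (R m) (Ssl m e s'))) else 0)
        (((Lc ^ m : ℕ) : ℤ) • (-u)) μ ν| ≤ B7 1)
    (hL2 : ∀ m : ℕ, 1 ≤ m → ∀ S' : Finset Pt, ∑ u ∈ S', (supNorm u : ℝ) ^ 2 *
      |dressedEntryP (fun c'' a' => colH (KPerf (d := 3) Lc (sfStep Lc) (smStep 3 Lc) m) (Lc ^ m) a' 0 c'')
        (fun c' e s s' => if supNorm (s' - s) ≤ Lc ^ m then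
          -((1 / 2 : ℝ) * κ m) * tr (comp (comp (R m) (Ssl m c' s)) (comp (c m • blk Pker true true) (Ssl m e s'))) else 0)
        (((Lc ^ m : ℕ) : ℤ) • (-u)) μ ν| ≤ B7 2)
    (hL3 : ∀ m : ℕ, 1 ≤ m → ∀ S' : Finset Pt, ∑ u ∈ S', (supNorm u : ℝ) ^ 2 *
      |dressedEntryP (fun c'' a' => colH (KPerf (d := 3) Lc (sfStep Lc) (smStep 3 Lc) m) (Lc ^ m) a' 0 c'')
        (fun c' e s s' => if supNorm (s' - s) ≤ Lc ^ m then -((1 / 2 : ℝ) * κ m) * bubble (R m) (Ssl m c' s) (Ssl m e s') else 0)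
        (((Lc ^ m : ℕ) : ℤ) • (-u)) μ ν| ≤ B7 3)
    (hL4 : ∀ m : ℕ, 1 ≤ m → ∀ S' : Finset Pt, ∑ u ∈ S', (supNorm u : ℝ) ^ 2 *
      |dressedEntryP (fun c'' a' => colH (KPerf (d := 3) Lc (sfStep Lc) (smStep 3 Lc) m) (Lc ^ m) a' 0 c'')
        (fun c' e s s' => if supNorm (s' - s) ≤ Lc ^ m then
          (1 / 2 : ℝ) * tadpole (c m • blk Pker true true) (Wsl m c' s e s' - b m • blk (W c' s e s') true true) else 0)
        (((Lc ^ m : ℕ) : ℤ) • (-u)) μ ν| ≤ B7 4)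
    (hL5 : ∀ m : ℕ, 1 ≤ m → ∀ S' : Finset Pt, ∑ u ∈ S', (supNorm u : ℝ) ^ 2 *
      |dressedEntryP (fun c'' a' => colH (KPerf (d := 3) Lc (sfStep Lc) (smStep 3 Lc) m) (Lc ^ m) a' 0 c'')
        (fun c' e s s' => if supNorm (s' - s) ≤ Lc ^ m then
          -((1 / 2 : ℝ) * κ m) * bubble (c m • blk Pker true true) (Ssl m c' s - a m • blk (V c' s) true true) (Ssl m e s') else 0)
        (((Lc ^ m : ℕ) : ℤ) • (-u)) μ ν| ≤ B7 5)
    (hL6 : ∀ m : ℕ, 1 ≤ m → ∀ S' : Finset Pt, ∑ u ∈ S', (supNorm u : ℝ) ^ 2 *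
      |dressedEntryP (fun c'' a' => colH (KPerf (d := 3) Lc (sfStep Lc) (smStep 3 Lc) m) (Lc ^ m) a' 0 c'')
        (fun c' e s s' => if supNorm (s' - s) ≤ Lc ^ m then
          -((1 / 2 : ℝ) * κ m) * bubble (c m • blk Pker true true) (a m • blk (V c' s) true true) (Ssl m e s' - a m • blk (V e s') true true) else 0)
        (((Lc ^ m : ℕ) : ℤ) • (-u)) μ ν| ≤ B7 6)
    (hLmix : ∀ k ∈ JM, ∀ m : ℕ, 1 ≤ m → ∀ S' : Finset Pt, ∑ u ∈ S', (supNorm u : ℝ) ^ 2 *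
      |dressedEntryP (fun c'' a' => colH (KPerf (d := 3) Lc (sfStep Lc) (smStep 3 Lc) m) (Lc ^ m) a' 0 c'') (Gmix k m)
        (((Lc ^ m : ℕ) : ℤ) • (-u)) μ ν| ≤ Bmix k)
    (hLgh : ∀ k ∈ JG, ∀ m : ℕ, 1 ≤ m → ∀ S' : Finset Pt, ∑ u ∈ S', (supNorm u : ℝ) ^ 2 *
      |dressedEntryP (fun c'' a' => colH (KPerf (d := 3) Lc (sfStep Lc) (smStep 3 Lc) m) (Lc ^ m) a' 0 c'') (Ggh k m)
        (((Lc ^ m : ℕ) : ℤ) • (-u)) μ ν| ≤ Bgh k)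
    (hLN : ∀ m : ℕ, 1 ≤ m → ∀ S' : Finset Pt, ∑ u ∈ S', (supNorm u : ℝ) ^ 2 *
      |dressedEntryP (fun c'' a' => colH (KPerf (d := 3) Lc (sfStep Lc) (smStep 3 Lc) m) (Lc ^ m) a' 0 c'')
        (fun c' e s s' => if supNorm (s' - s) ≤ Lc ^ m then FN m c' e s s' else 0)
        (((Lc ^ m : ℕ) : ℤ) • (-u)) μ ν| ≤ BN)
    -- THE STEP DOOR AND THE SYMMETRY DOOR, OPENED DOWN TO FINITE-`j` ROWS (R-FP-40 (C)): the WARD and TRANSPOSITION laws of the wall's own kernels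
    -- `TbalOf Lc Js j` at EVERY `j`, and (SDF) — NO X1m-W row of the FULL (j, m)-tables (the full slot's class data follows from the W-split, §1)
    (hWj : ∀ j, WardTransversal (flipK (TbalOf Lc (JsB12Sym hOdd Ncol tabs cΛ cB) j)))
    -- `hTj` (the transposition law of `TbalOf Lc (JsB12Sym …) j`) is leaf-01's THEOREM `RoadLeftLiteralSwap.hTj_JsB12Sym` — DISCHARGED inside
    (hSDF : ∀ m : ℕ, 1 ≤ m → B12Beta.secondMoment (defect
      (fun m => hessKer (KPerf (d := 3) Lc (sfStep Lc) (smStep 3 Lc) m)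
        (vertexOfK (KPerf (d := 3) Lc (sfStep Lc) (smStep 3 Lc) m) (Lc ^ m)
          (SPerfPin Lc (fun j => (JsB12Sym hOdd Ncol tabs cΛ cB j).S) (SfoldComp Lc (qSym Lc) lamPerfect tabs.V Spure cVHc SLam) m))
            (WPerfPin Lc (fun j => (JsB12Sym hOdd Ncol tabs cΛ cB j).W) (WtComp Lc (qSym Lc) lamPerfect Spure cVHc ε₂ Gc tabs cΛ S₂inf cBc) m))
      (fun m a b z => ((Lc ^ m : ℕ) : ℝ) ^ 8 * dressedEntry (colOf (KPerf (d := 3) Lc (sfStep Lc) (smStep 3 Lc) m))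
        (hessKer (KPerf (d := 3) Lc (sfStep Lc) (smStep 3 Lc) 1)
          (vertexOfK (KPerf (d := 3) Lc (sfStep Lc) (smStep 3 Lc) 1) Lc
            (SPerfPin Lc (fun j => (JsB12Sym hOdd Ncol tabs cΛ cB j).S) (SfoldComp Lc (qSym Lc) lamPerfect tabs.V Spure cVHc SLam) 1))
              (WPerfPin Lc (fun j => (JsB12Sym hOdd Ncol tabs cΛ cB j).W) (WtComp Lc (qSym Lc) lamPerfect Spure cVHc ε₂ Gc tabs cΛ S₂inf cBc) 1))
        (((Lc ^ m : ℕ) : ℤ) • z) a b) m) μ ν = 0)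
    -- the W-slot split of the perfect second-order slot (row #14): the split, ONE `VertexFamily₂` letter of the EXTRA slot `Wx m`, and the extra piece's
    -- bound ((G8)∕(G-mix-W)); `hloc₀`∕`hs₀` (bi-vertex slot) and `hlocx`∕`hsx` (extra slot) are supplied inside (`BiVertexSlotLetters` §4)
    {Wx : ℕ → Fin (3 + 1) → (Fin (3 + 1) → ℤ) → Fin (3 + 1) → (Fin (3 + 1) → ℤ) → MKer (3 + 1) (Fib 3)}
    (hsplit : ∀ m : ℕ, 1 ≤ m →
      WPerfPin Lc (fun j => (JsB12Sym hOdd Ncol tabs cΛ cB j).W) (WtComp Lc (qSym Lc) lamPerfect Spure cVHc ε₂ Gc tabs cΛ S₂inf cBc) m = vertex2OfK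
        (KPerf (d := 3) Lc (sfStep Lc) (smStep 3 Lc) m) (Lc ^ m) (Wf m) + Wx m)
    (hWx : ∀ m : ℕ, 1 ≤ m → ∃ Cx δx : ℝ, 0 < δx ∧ VertexFamily₂ (Wx m) (Lc ^ m) Cx δx)
    {B : ℝ}
    (hextra : ∀ m : ℕ, 1 ≤ m →
      |B12Beta.secondMoment
          (fun μ' ν' z => (1 / 2 : ℝ) * tadpole (KPerf (d := 3) Lc (sfStep Lc) (smStep 3 Lc) m) (Wx m μ' 0 ν' z)) μ ν| ≤ B) :
    D1Drift Lc (JsB12Sym hOdd Ncol tabs cΛ cB) N μ ν := by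
  -- the two stencil letters of `SfoldComp … m` (`m ≥ 2`) from leaf-02's letters over the record inputs (`qSym_decays`, `SymTables.hV`∕`hVt`, `qSym_translate`) and `hL hδL hLt`
  obtain ⟨Cq, hCq, hq⟩ := qSym_decays (d := 3) (Lc := Lc) δsp hδsp.le
  obtain ⟨CV, hVrec⟩ := tabs.hV δsp hδsp.le
  have hEx : ∀ m : ℕ, 2 ≤ m → ∃ C δ' : ℝ, 0 < δ' ∧ LocStencil (SfoldComp Lc (qSym Lc) lamPerfect tabs.V Spure cVHc SLam m) C δ' :=
    fun m hm => locStencil_SfoldComp hq hCq hδsp hVrec hSp lamPerfect cVHc (by omega) (hL m hm) (hδL m hm)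
  choose! Csc δsc hδsc hSc using hEx
  have hcovc : ∀ m : ℕ, 2 ≤ m → ∀ (κ : Fin (3 + 1)) (u t : Fin (3 + 1) → ℤ),
      SfoldComp Lc (qSym Lc) lamPerfect tabs.V Spure cVHc SLam m κ (u + ((Lc ^ m : ℕ) : ℤ) • t)
        = shiftK (-(((Lc ^ m : ℕ) : ℤ) • t)) (SfoldComp Lc (qSym Lc) lamPerfect tabs.V Spure cVHc SLam m κ u) := fun m hm κ u t => by
    rw [SfoldComp_apply, SfoldComp_apply, SpureComp_translate (qSym_translate Lc) tabs.hVt hSpt lamPerfect cVHc (by omega) κ u t, hLt m hm κ u t]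
    rfl
  exact d1Drift_JsB12Sym_of_sliceLedger_ghost_SComp
    hLc hOdd Ncol tabs cΛ cB (SfoldComp Lc (qSym Lc) lamPerfect tabs.V Spure cVHc SLam) (WtComp Lc (qSym Lc) lamPerfect Spure cVHc ε₂ Gc tabs cΛ S₂inf
    cBc) hSc hδsc hcovc hS0 hSall0 hW0 hWall0 hδS hδW hθS0 hθS1 hθW0 hθW1 wg wgh hδ hV hW hcovV hcovW X hX hW1 hW2 hKcov h0V hgermV hWloc hn hμν hWf hCF
    haf hfar hunits₁ hunits₂ hRb hSsl hWsl hslice JM hmix hGmix JG hgh hGgh hFN hL0 hL1 hL2 hL3 hL4 hL5 hL6 hLmix hLgh hLN hWj hSDF hsplit hWx hextra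

end Summit.QuantumFields.BalabanUV.Beta.FP.RoadLeftLiteralSfoldComp

end
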